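import Literature.Analysis.FluidPDE.PlanarGraphBandKinematics
import HarnessLib

/-!
# The sheared graph band: material abscissa `ξ = x + λ (y - T)`

Topic `Literature/Analysis/FluidPDE`. Element kinematics of the explicit pullback calculus for
the planar transport equation, generalising `PlanarGraphBandKinematics.lean` by a constant
**shear parameter** `λ ∈ ℝ`: the material redistribution `Ξ(t, ·)` and its slope datum `Ξₓ` are
read at the sheared abscissa `ξ = x + λ (y - T(x))` instead of `x` (the graph `T` is STATIC here:
the shear is only ever used on static corner arms; moving profiles use `λ = 0`),

* `shGraphPullback lam T Ξ Ξx t (x, y) = (Ξ(t, ξ), (y - T(x)) / Ξₓ(t, ξ))`,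
* `shGraphVelocity lam g gx T Tx t (x, y) = (g + λ s gₓ, Tₓ g - (1 - λ Tₓ) s gₓ)`, `s = y - T(x)`,
  the rates `g, gₓ` read at `(t, ξ)`,
* `shGraphStream lam g T t (x, y) = g(t, ξ) (y - T(x))`.

For `λ = 0` these are the graph band (`shGraphPullback_zero`, `shGraphVelocity_zero`,
`shGraphStream_zero`). The point (folklore linear algebra): the Jacobian of
`(x, y) ↦ (Ξ(t,ξ), (y - T)/Ξₓ(t,ξ))` is IDENTICALLY `1` for constant `λ` (the `Ξₓₓ` terms cancel),
so the sheared band is moved by a divergence-free velocity exactly as the graph band is, while on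
an arm of slope `σ = ∂ₓT` the abscissa `ξ` is constant along the normals iff `λ = σ/(1+σ²)`:
with `λ = ± 1/2` a width transition carried by a diagonal-frame corner arm of slope `± 1` is the
UNSHEARED transition of a run element (`PlanarRunElement.lean`), which is what lets a width kink
be handed between run-hosted and corner-hosted descriptions
(`PlanarRedescription.lean`). In a constant-slope stretch of `Ξ` (a gap of the material map) the
scalar and the velocity do not depend on `λ` (`shGraphVelocity_eq_of_gap`).

Folklore; no named facts. Infrastructure towards a discharge of `acm_compatible_blocks`
(`QuasiSelfSimilarCompatibleBlocks.lean`).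

## References

* G. Alberti, G. Crippa, A. L. Mazzucato, *Exponential self-similar mixing by incompressible
  flows*, J. Amer. Math. Soc. 32 (2019), 445–490, §7 (arXiv:1605.02090).
-/

noncomputable section

open Function Set Filter
open scoped Topology ContDiff

namespace Literature.Analysis.FluidPDE

namespace PlanarKinematics

/-- The plane `ℝ²` as a Euclidean space. [folklore] -/
local notation "E²" => EuclideanSpace ℝ (Fin 2)

variable {G : Type*} [NormedAddCommGroup G] [NormedSpace ℝ G]

/-! ## Definitions (static graph `T`; the shear is used only on static corner arms) -/

/-- **Sheared abscissa** `ξ((x, y)) = x + λ (y - T(x))` of a STATIC graph `y = T(x)`. [folklore] -/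
def shAbscissa (lam : ℝ) (T : ℝ → ℝ) (w : E²) : ℝ := w 0 + lam * (w 1 - T (w 0))

/-- **Sheared graph band, material coordinates**:
`Ψ(t, (x, y)) = (Ξ(t, ξ), (y - T(x))/Ξₓ(t, ξ))`, `ξ = x + λ (y - T(x))`. [folklore] -/
def shGraphPullback (lam : ℝ) (T : ℝ → ℝ) (Ξ Ξx : ℝ → ℝ → ℝ) (t : ℝ) (w : E²) : E² :=
  vec2 (Ξ t (shAbscissa lam T w)) ((w 1 - T (w 0)) / Ξx t (shAbscissa lam T w))

/-- **Sheared graph band, velocity**: `V(t, (x, y)) = (g + λ s gₓ, Tₓ g - (1 - λ Tₓ) s gₓ)`,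
`s = y - T(x)`, with the rates `g, gₓ` (`axialRate`, `axialRateDeriv` of `Ξ`) read at `(t, ξ)`
and the slope `Tₓ` at `x`. [folklore] -/
def shGraphVelocity (lam : ℝ) (g gx : ℝ → ℝ → ℝ) (T Tx : ℝ → ℝ) (t : ℝ) (w : E²) : E² :=
  vec2 (g t (shAbscissa lam T w) + lam * (w 1 - T (w 0)) * gx t (shAbscissa lam T w))
    (Tx (w 0) * g t (shAbscissa lam T w) -
      (1 - lam * Tx (w 0)) * (w 1 - T (w 0)) * gx t (shAbscissa lam T w))

/-- **Sheared graph band, stream function**: `H(t, (x, y)) = g(t, ξ) (y - T(x))`; then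
`V = (∂_yH, -∂ₓH)`. [folklore] -/
def shGraphStream (lam : ℝ) (g : ℝ → ℝ → ℝ) (T : ℝ → ℝ) (t : ℝ) (w : E²) : ℝ :=
  g t (shAbscissa lam T w) * (w 1 - T (w 0))

/-! ## Unfolding and the graph band as the case `λ = 0` -/

/-- Unfolding the sheared abscissa. [folklore] -/
@[simp]
theorem shAbscissa_apply (lam : ℝ) (T : ℝ → ℝ) (w : E²) :
    shAbscissa lam T w = w 0 + lam * (w 1 - T (w 0)) := rfl

/-- Unfolding the sheared pullback. [folklore] -/
@[simp]
theorem shGraphPullback_apply (lam : ℝ) (T : ℝ → ℝ) (Ξ Ξx : ℝ → ℝ → ℝ) (t : ℝ) (w : E²) :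
    shGraphPullback lam T Ξ Ξx t w =
      vec2 (Ξ t (shAbscissa lam T w)) ((w 1 - T (w 0)) / Ξx t (shAbscissa lam T w)) := rfl

/-- Unfolding the sheared velocity. [folklore] -/
@[simp]
theorem shGraphVelocity_apply (lam : ℝ) (g gx : ℝ → ℝ → ℝ) (T Tx : ℝ → ℝ) (t : ℝ) (w : E²) :
    shGraphVelocity lam g gx T Tx t w =
      vec2 (g t (shAbscissa lam T w) + lam * (w 1 - T (w 0)) * gx t (shAbscissa lam T w))
        (Tx (w 0) * g t (shAbscissa lam T w) -
          (1 - lam * Tx (w 0)) * (w 1 - T (w 0)) * gx t (shAbscissa lam T w)) := rfl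

/-- Unfolding the sheared stream function. [folklore] -/
@[simp]
theorem shGraphStream_apply (lam : ℝ) (g : ℝ → ℝ → ℝ) (T : ℝ → ℝ) (t : ℝ) (w : E²) :
    shGraphStream lam g T t w = g t (shAbscissa lam T w) * (w 1 - T (w 0)) := rfl

/-- No shear: the abscissa is `x`. [folklore] -/
@[simp]
theorem shAbscissa_zero (T : ℝ → ℝ) (w : E²) : shAbscissa 0 T w = w 0 := by
  simp [shAbscissa]

/-- **No shear gives the graph band** of the static graph (pullback). [folklore] -/
theorem shGraphPullback_zero (T : ℝ → ℝ) (Ξ Ξx : ℝ → ℝ → ℝ) :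
    shGraphPullback 0 T Ξ Ξx = graphPullback (fun _ => T) Ξ Ξx := by
  funext t w
  rw [shGraphPullback_apply, graphPullback_apply, shAbscissa_zero]

/-- **No shear gives the graph band** of the static graph (velocity: `Tₜ = 0`). [folklore] -/
theorem shGraphVelocity_zero (g gx : ℝ → ℝ → ℝ) (T Tx : ℝ → ℝ) :
    shGraphVelocity 0 g gx T Tx = graphVelocity g gx (fun _ => T) (fun _ _ => 0) (fun _ => Tx) := by
  funext t w
  rw [shGraphVelocity_apply, graphVelocity_apply, shAbscissa_zero]
  congr 1 <;> ring

/-- **No shear gives the graph band** of the static graph (stream function, `P = 0`). [folklore] -/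
theorem shGraphStream_zero (g : ℝ → ℝ → ℝ) (T : ℝ → ℝ) :
    shGraphStream 0 g T = graphStream g (fun _ => T) (fun _ _ => 0) := by
  funext t w
  rw [shGraphStream_apply, graphStream_apply, shAbscissa_zero, sub_zero]

/-! ## The sheared abscissa on an arm: unshearing -/

/-- **The sheared abscissa is constant along the normals of an arm of slope `σ`** when
`λ (1 + σ²) = σ`: on the line `y = y₀ + σ (x - x₀)` (so `T(x) = y₀ + σ (x - x₀)` there), moving
by `h` along the normal `(-σ, 1)` does not change `ξ`. This is the algebra behind the choice
`λ = ± 1/2` on the arms of slope `± 1` of a diagonal-frame corner. [folklore] -/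
theorem shAbscissa_normal_invariant {lam σ x₀ y₀ : ℝ} (hlam : lam * (1 + σ ^ 2) = σ)
    {T : ℝ → ℝ} (hT : ∀ x, T x = y₀ + σ * (x - x₀)) (w : E²) (h : ℝ) :
    shAbscissa lam T (vec2 (w 0 - σ * h) (w 1 + h)) = shAbscissa lam T w := by
  simp only [shAbscissa_apply, vec2_apply_zero, vec2_apply_one, hT]
  linear_combination h * hlam

/-! ## Gap regime: the shear is invisible where the slope of `Ξ` is locally constant -/

/-- **In a gap of the material map the velocity does not depend on the shear**: if the rate
derivative `gₓ(t, ·)` vanishes identically and `g(t, ·)` is constant, the sheared velocity is the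
graph-band velocity of the static graph, whatever `λ`. [folklore] -/
theorem shGraphVelocity_eq_of_gap {lam : ℝ} {g gx : ℝ → ℝ → ℝ} {T Tx : ℝ → ℝ} {t : ℝ} {c : ℝ}
    (hg : ∀ a, g t a = c) (hgx : ∀ a, gx t a = 0) (w : E²) :
    shGraphVelocity lam g gx T Tx t w =
      graphVelocity g gx (fun _ => T) (fun _ _ => 0) (fun _ => Tx) t w := by
  rw [shGraphVelocity_apply, graphVelocity_apply]
  simp only [hg, hgx, mul_zero, sub_zero, zero_add, add_zero]

/-- **In a gap the transverse coordinate does not depend on the shear** and the material one is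
shifted by `λ W (y - T)`: if `Ξₓ(t, ·)` is the constant `W` and `Ξ(t, a) = U + W a`. [folklore] -/
theorem shGraphPullback_gap {lam : ℝ} {T : ℝ → ℝ} {Ξ Ξx : ℝ → ℝ → ℝ} {t U W : ℝ}
    (hΞ : ∀ a, Ξ t a = U + W * a) (hΞx : ∀ a, Ξx t a = W) (w : E²) :
    shGraphPullback lam T Ξ Ξx t w =
      vec2 (graphPullback (fun _ => T) Ξ Ξx t w 0 + lam * W * (w 1 - T (w 0)))
        (graphPullback (fun _ => T) Ξ Ξx t w 1) := by
  rw [shGraphPullback_apply, graphPullback_apply, vec2_apply_zero, vec2_apply_one]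
  simp only [shAbscissa_apply, hΞ, hΞx]
  congr 1
  ring

/-! ## Derivatives of the sheared pullback -/

/-- **Derivative of the sheared abscissa**: `Dξ(z)[v] = (1 - λ Tₓ) v₀ + λ v₁`. [folklore] -/
theorem hasFDerivAt_shAbscissa {lam : ℝ} {T Tx : ℝ → ℝ} {z : E²} (hTx : HasDerivAt T (Tx (z 0)) (z 0)) :
    HasFDerivAt (shAbscissa lam T)
      ((1 - lam * Tx (z 0)) • (EuclideanSpace.proj (0 : Fin 2) : E² →L[ℝ] ℝ) +
        lam • (EuclideanSpace.proj (1 : Fin 2) : E² →L[ℝ] ℝ)) z := by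
  have hg : DifferentiableAt ℝ (uncurry fun a b : ℝ => a + lam * (b - T a)) (z 0, z 1) := by
    have h2 : DifferentiableAt ℝ (fun p : ℝ × ℝ => T p.1) (z 0, z 1) :=
      hTx.differentiableAt.comp (z 0, z 1) differentiableAt_fst
    exact differentiableAt_fst.add ((differentiableAt_snd.sub h2).const_mul lam)
  have h0 : HasDerivAt (fun a => a + lam * (z 1 - T a)) (1 - lam * Tx (z 0)) (z 0) :=
    ((hasDerivAt_id (z 0)).add ((hTx.const_sub (z 1)).const_mul lam)).congr_deriv (by ring)
  have h1 : HasDerivAt (fun b => z 0 + lam * (b - T (z 0))) lam (z 1) :=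
    ((((hasDerivAt_id (z 1)).sub_const (T (z 0))).const_mul lam).const_add (z 0)).congr_deriv (by ring)
  exact hasFDerivAt_coordFun (g := fun a b : ℝ => a + lam * (b - T a)) hg h0 h1

/-- **Time derivative of the sheared pullback** (static graph):
`∂ₜΨ(t,z) = (Ξₜ(t,ξ), (z₁ - T(z₀)) (-Ξₓₜ(t,ξ)/Ξₓ(t,ξ)²))`. [folklore] -/
theorem hasDerivAt_shGraphPullback {lam : ℝ} {T : ℝ → ℝ} {Ξ Ξx Ξt Ξxt : ℝ → ℝ → ℝ} {t : ℝ} {z : E²}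
    (ht : HasDerivAt (fun s => Ξ s (shAbscissa lam T z)) (Ξt t (shAbscissa lam T z)) t)
    (hxt : HasDerivAt (fun s => Ξx s (shAbscissa lam T z)) (Ξxt t (shAbscissa lam T z)) t)
    (hne : Ξx t (shAbscissa lam T z) ≠ 0) :
    HasDerivAt (fun s => shGraphPullback lam T Ξ Ξx s z)
      (vec2 (Ξt t (shAbscissa lam T z))
        ((z 1 - T (z 0)) * (-Ξxt t (shAbscissa lam T z) / Ξx t (shAbscissa lam T z) ^ 2))) t := by
  have hinvt : HasDerivAt (fun s => (Ξx s (shAbscissa lam T z))⁻¹)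
      (-Ξxt t (shAbscissa lam T z) / Ξx t (shAbscissa lam T z) ^ 2) t := hxt.fun_inv hne
  have h := hasDerivAt_vec2 ht (hinvt.const_mul (z 1 - T (z 0)))
  have hfun : (fun s => shGraphPullback lam T Ξ Ξx s z) =
      fun s => vec2 (Ξ s (shAbscissa lam T z)) ((z 1 - T (z 0)) * (Ξx s (shAbscissa lam T z))⁻¹) := by
    funext s; rw [shGraphPullback_apply, div_eq_mul_inv]
  rw [hfun]
  exact h

/-- **Space derivative of the sheared pullback**: with `ξ₀ = ξ(z)`, `s = z₁ - T(z₀)`,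
`a = 1 - λ Tₓ(z₀)`,
`D_zΨ(t,z)[v] = (Ξₓ (a v₀ + λ v₁), (-Tₓ/Ξₓ - s Ξₓₓ a/Ξₓ²) v₀ + (1/Ξₓ - s Ξₓₓ λ/Ξₓ²) v₁)`,
`Ξₓ, Ξₓₓ` at `(t, ξ₀)`. [folklore] -/
theorem hasFDerivAt_shGraphPullback {lam : ℝ} {T Tx : ℝ → ℝ} {Ξ Ξx Ξxx : ℝ → ℝ → ℝ} {t : ℝ} {z : E²}
    (hTx : HasDerivAt T (Tx (z 0)) (z 0))
    (hx : HasDerivAt (Ξ t) (Ξx t (shAbscissa lam T z)) (shAbscissa lam T z))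
    (hxx : HasDerivAt (Ξx t) (Ξxx t (shAbscissa lam T z)) (shAbscissa lam T z))
    (hne : Ξx t (shAbscissa lam T z) ≠ 0) :
    HasFDerivAt (shGraphPullback lam T Ξ Ξx t)
      (((Ξx t (shAbscissa lam T z) * (1 - lam * Tx (z 0))) •
            (EuclideanSpace.proj (0 : Fin 2) : E² →L[ℝ] ℝ) +
          (Ξx t (shAbscissa lam T z) * lam) • (EuclideanSpace.proj (1 : Fin 2) : E² →L[ℝ] ℝ)).smulRight
          (EuclideanSpace.single 0 1) +
        ((-Tx (z 0) * (Ξx t (shAbscissa lam T z))⁻¹ +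
              (z 1 - T (z 0)) * (-Ξxx t (shAbscissa lam T z) / Ξx t (shAbscissa lam T z) ^ 2 *
                (1 - lam * Tx (z 0)))) •
              (EuclideanSpace.proj (0 : Fin 2) : E² →L[ℝ] ℝ) +
            ((Ξx t (shAbscissa lam T z))⁻¹ +
              (z 1 - T (z 0)) * (-Ξxx t (shAbscissa lam T z) / Ξx t (shAbscissa lam T z) ^ 2 * lam)) •
              (EuclideanSpace.proj (1 : Fin 2) : E² →L[ℝ] ℝ)).smulRight
          (EuclideanSpace.single 1 1)) z := by
  set ξ₀ := shAbscissa lam T z with hξ₀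
  set P0 := (EuclideanSpace.proj (0 : Fin 2) : E² →L[ℝ] ℝ)
  set P1 := (EuclideanSpace.proj (1 : Fin 2) : E² →L[ℝ] ℝ)
  have hξ : HasFDerivAt (shAbscissa lam T) ((1 - lam * Tx (z 0)) • P0 + lam • P1) z :=
    hasFDerivAt_shAbscissa hTx
  -- first component `Ξ t (ξ w)`
  have hP : HasFDerivAt (fun w : E² => Ξ t (shAbscissa lam T w))
      ((Ξx t ξ₀ * (1 - lam * Tx (z 0))) • P0 + (Ξx t ξ₀ * lam) • P1) z := by
    refine (hx.comp_hasFDerivAt z hξ).congr_fderiv ?_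
    ext v
    simp only [_root_.add_apply, _root_.smul_apply, smul_eq_mul]
    ring
  -- the inverse slope `(Ξx t (ξ w))⁻¹`
  have hI : HasFDerivAt (fun w : E² => (Ξx t (shAbscissa lam T w))⁻¹)
      ((-Ξxx t ξ₀ / Ξx t ξ₀ ^ 2 * (1 - lam * Tx (z 0))) • P0 + (-Ξxx t ξ₀ / Ξx t ξ₀ ^ 2 * lam) • P1) z := by
    have hinv : HasDerivAt (fun a => (Ξx t a)⁻¹) (-Ξxx t ξ₀ / Ξx t ξ₀ ^ 2) ξ₀ := hxx.fun_inv hne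
    refine (hinv.comp_hasFDerivAt z hξ).congr_fderiv ?_
    ext v
    simp only [_root_.add_apply, _root_.smul_apply, smul_eq_mul]
    ring
  -- the transverse offset `w 1 - T (w 0)`
  have hS : HasFDerivAt (fun w : E² => w 1 - T (w 0)) ((-Tx (z 0)) • P0 + (1 : ℝ) • P1) z := by
    have hg : DifferentiableAt ℝ (uncurry fun a b : ℝ => b - T a) (z 0, z 1) := by
      have h2 : DifferentiableAt ℝ (fun p : ℝ × ℝ => T p.1) (z 0, z 1) :=
        hTx.differentiableAt.comp (z 0, z 1) differentiableAt_fst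
      exact differentiableAt_snd.sub h2
    have h0 : HasDerivAt (fun a => z 1 - T a) (-Tx (z 0)) (z 0) := hTx.const_sub (z 1)
    have h1 : HasDerivAt (fun b => b - T (z 0)) 1 (z 1) := (hasDerivAt_id (z 1)).sub_const _
    exact hasFDerivAt_coordFun (g := fun a b : ℝ => b - T a) hg h0 h1
  have hQ : HasFDerivAt (fun w : E² => (w 1 - T (w 0)) * (Ξx t (shAbscissa lam T w))⁻¹)
      ((-Tx (z 0) * (Ξx t ξ₀)⁻¹ + (z 1 - T (z 0)) * (-Ξxx t ξ₀ / Ξx t ξ₀ ^ 2 * (1 - lam * Tx (z 0)))) • P0 +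
        ((Ξx t ξ₀)⁻¹ + (z 1 - T (z 0)) * (-Ξxx t ξ₀ / Ξx t ξ₀ ^ 2 * lam)) • P1) z := by
    refine (hS.mul hI).congr_fderiv ?_
    ext v
    simp only [_root_.add_apply, _root_.smul_apply, smul_eq_mul, hξ₀]
    ring
  have hfun : shGraphPullback lam T Ξ Ξx t =
      fun w => vec2 (Ξ t (shAbscissa lam T w)) ((w 1 - T (w 0)) * (Ξx t (shAbscissa lam T w))⁻¹) := by
    funext w; rw [shGraphPullback_apply, div_eq_mul_inv]
  rw [hfun]
  exact hasFDerivAt_vec2 hP hQ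

/-! ## Pullback identity, incompressibility, transport -/

/-- **Pullback identity of the sheared band**: with `Ξₜ, Ξₓ` the partials of `Ξ`, `Ξₓₓ, Ξₓₜ` those
of `Ξₓ` at `(t, ξ(z))`, `Tₓ` the slope of the static graph at `z₀`, and `Ξₓ(t, ξ(z)) ≠ 0`, the
pair (`shGraphPullback`, `shGraphVelocity` of the rate `g = -Ξₜ/Ξₓ`, its `x`-derivative and
`T, Tₓ`) satisfies `∂ₜΨ + D_zΨ[V] = 0` at `(t, z)`: the Jacobian of `Ψ(t,·)` is `1`, and
`V = -(D_zΨ)⁻¹ ∂ₜΨ`. [folklore] -/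
theorem shGraph_pullback_identity {lam : ℝ} {T Tx : ℝ → ℝ} {Ξ Ξx Ξt Ξxx Ξxt : ℝ → ℝ → ℝ} {t : ℝ}
    {z : E²} (hTx : HasDerivAt T (Tx (z 0)) (z 0))
    (ht : HasDerivAt (fun s => Ξ s (shAbscissa lam T z)) (Ξt t (shAbscissa lam T z)) t)
    (hx : HasDerivAt (Ξ t) (Ξx t (shAbscissa lam T z)) (shAbscissa lam T z))
    (hxx : HasDerivAt (Ξx t) (Ξxx t (shAbscissa lam T z)) (shAbscissa lam T z))
    (hxt : HasDerivAt (fun s => Ξx s (shAbscissa lam T z)) (Ξxt t (shAbscissa lam T z)) t)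
    (hne : Ξx t (shAbscissa lam T z) ≠ 0) :
    deriv (fun s => shGraphPullback lam T Ξ Ξx s z) t +
      fderiv ℝ (shGraphPullback lam T Ξ Ξx t) z
        (shGraphVelocity lam (axialRate Ξx Ξt) (axialRateDeriv Ξx Ξt Ξxx Ξxt) T Tx t z) = 0 := by
  set X := Ξx t (shAbscissa lam T z) with hX
  set S := Ξt t (shAbscissa lam T z) with hS
  set XX := Ξxx t (shAbscissa lam T z) with hXX
  set XT := Ξxt t (shAbscissa lam T z) with hXT
  set A := T (z 0) with hA
  set Ax := Tx (z 0) with hAx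
  have hV : shGraphVelocity lam (axialRate Ξx Ξt) (axialRateDeriv Ξx Ξt Ξxx Ξxt) T Tx t z =
      vec2 (-S / X + lam * (z 1 - A) * (-(XT * X - S * XX) / X ^ 2))
        (Ax * (-S / X) - (1 - lam * Ax) * (z 1 - A) * (-(XT * X - S * XX) / X ^ 2)) := rfl
  rw [(hasDerivAt_shGraphPullback ht hxt hne).deriv, (hasFDerivAt_shGraphPullback hTx hx hxx hne).fderiv,
    hV]
  simp only [_root_.add_apply, ContinuousLinearMap.smulRight_apply, _root_.smul_apply, smul_eq_mul,
    show ∀ a b : ℝ, (EuclideanSpace.proj (0 : Fin 2) : E² →L[ℝ] ℝ) (vec2 a b) = a from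
      fun a b => vec2_apply_zero a b,
    show ∀ a b : ℝ, (EuclideanSpace.proj (1 : Fin 2) : E² →L[ℝ] ℝ) (vec2 a b) = b from
      fun a b => vec2_apply_one a b]
  rw [show ∀ a b : ℝ, a • (EuclideanSpace.single 0 1 : E²) + b • (EuclideanSpace.single 1 1 : E²) =
      vec2 a b from fun a b => rfl]
  rw [vec2_add_vec2, vec2_eq_zero_iff, ← hX, ← hXX, ← hXT, ← hS, ← hA, ← hAx]
  constructor
  · field_simp
    ring
  · field_simp
    ring

/-- **The sheared velocity is divergence free**:
`∂ₓ(g + λ s gₓ) + ∂_y(Tₓ g - (1 - λTₓ) s gₓ) = 0` (the `gₓₓ` terms cancel), given that `gₓ(t,·)`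
is the derivative of `g(t,·)` at `ξ(z)` and the one-dimensional data are differentiable.
[folklore] -/
theorem divergence_shGraphVelocity {lam : ℝ} {g gx : ℝ → ℝ → ℝ} {T Tx : ℝ → ℝ} {t : ℝ} {z : E²}
    (hg : HasDerivAt (g t) (gx t (shAbscissa lam T z)) (shAbscissa lam T z))
    (hgx : DifferentiableAt ℝ (gx t) (shAbscissa lam T z))
    (hT : HasDerivAt T (Tx (z 0)) (z 0)) (hTx : DifferentiableAt ℝ Tx (z 0)) :
    ∑ j, fderiv ℝ (shGraphVelocity lam g gx T Tx t) z (EuclideanSpace.single j 1) j = 0 := by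
  set ξ₀ := shAbscissa lam T z with hξ₀
  -- the two components as functions of the two coordinates
  set P : ℝ → ℝ → ℝ := fun a b => g t (a + lam * (b - T a)) + lam * (b - T a) * gx t (a + lam * (b - T a))
    with hPdef
  set Q : ℝ → ℝ → ℝ := fun a b => Tx a * g t (a + lam * (b - T a)) -
      (1 - lam * Tx a) * (b - T a) * gx t (a + lam * (b - T a)) with hQdef
  have hV : shGraphVelocity lam g gx T Tx t = fun w => vec2 (P (w 0) (w 1)) (Q (w 0) (w 1)) := by
    funext w; rfl
  obtain ⟨gxx, hgxx⟩ : ∃ gxx, HasDerivAt (gx t) gxx ξ₀ := ⟨_, hgx.hasDerivAt⟩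
  obtain ⟨Txx, hTxx⟩ : ∃ Txx, HasDerivAt Tx Txx (z 0) := ⟨_, hTx.hasDerivAt⟩
  have hξeq : z 0 + lam * (z 1 - T (z 0)) = ξ₀ := by rw [hξ₀, shAbscissa_apply]
  -- slices of the abscissa
  have hξa : HasDerivAt (fun a => a + lam * (z 1 - T a)) (1 - lam * Tx (z 0)) (z 0) :=
    ((hasDerivAt_id (z 0)).add ((hT.const_sub (z 1)).const_mul lam)).congr_deriv (by ring)
  have hξb : HasDerivAt (fun b => z 0 + lam * (b - T (z 0))) lam (z 1) :=
    ((((hasDerivAt_id (z 1)).sub_const (T (z 0))).const_mul lam).const_add (z 0)).congr_deriv (by ring)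
  have hga : HasDerivAt (fun a => g t (a + lam * (z 1 - T a))) (gx t ξ₀ * (1 - lam * Tx (z 0))) (z 0) := by
    have h := (hξeq ▸ hg).comp (z 0) hξa
    exact h
  have hgb : HasDerivAt (fun b => g t (z 0 + lam * (b - T (z 0)))) (gx t ξ₀ * lam) (z 1) :=
    (hξeq ▸ hg).comp (z 1) hξb
  have hgxa : HasDerivAt (fun a => gx t (a + lam * (z 1 - T a))) (gxx * (1 - lam * Tx (z 0))) (z 0) :=
    (hξeq ▸ hgxx).comp (z 0) hξa
  have hgxb : HasDerivAt (fun b => gx t (z 0 + lam * (b - T (z 0)))) (gxx * lam) (z 1) :=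
    (hξeq ▸ hgxx).comp (z 1) hξb
  have hsa : HasDerivAt (fun a => z 1 - T a) (-Tx (z 0)) (z 0) := hT.const_sub (z 1)
  have hsb : HasDerivAt (fun b => b - T (z 0)) 1 (z 1) := (hasDerivAt_id (z 1)).sub_const _
  -- joint differentiability
  have h0 : ∀ {f : ℝ → ℝ} {x : ℝ}, DifferentiableAt ℝ f x → ∀ {φ : ℝ × ℝ → ℝ},
      DifferentiableAt ℝ φ (z 0, z 1) → φ (z 0, z 1) = x →
      DifferentiableAt ℝ (fun p : ℝ × ℝ => f (φ p)) (z 0, z 1) :=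
    fun hf _ hφ hx => (hx ▸ hf).comp (z 0, z 1) hφ
  have hTp : DifferentiableAt ℝ (fun p : ℝ × ℝ => T p.1) (z 0, z 1) :=
    hT.differentiableAt.comp (z 0, z 1) differentiableAt_fst
  have hTxp : DifferentiableAt ℝ (fun p : ℝ × ℝ => Tx p.1) (z 0, z 1) :=
    hTx.comp (z 0, z 1) differentiableAt_fst
  have hsp : DifferentiableAt ℝ (fun p : ℝ × ℝ => p.2 - T p.1) (z 0, z 1) := differentiableAt_snd.sub hTp
  have hξp : DifferentiableAt ℝ (fun p : ℝ × ℝ => p.1 + lam * (p.2 - T p.1)) (z 0, z 1) :=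
    differentiableAt_fst.add (hsp.const_mul lam)
  have hξp0 : (fun p : ℝ × ℝ => p.1 + lam * (p.2 - T p.1)) (z 0, z 1) = ξ₀ := hξeq
  have hgp := h0 hg.differentiableAt hξp hξp0
  have hgxp := h0 hgx hξp hξp0
  have hPj : DifferentiableAt ℝ (uncurry P) (z 0, z 1) := by
    have e : uncurry P = fun p : ℝ × ℝ =>
        g t (p.1 + lam * (p.2 - T p.1)) + lam * (p.2 - T p.1) * gx t (p.1 + lam * (p.2 - T p.1)) := by
      funext p; rfl
    rw [e]; exact hgp.add ((hsp.const_mul lam).mul hgxp)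
  have hQj : DifferentiableAt ℝ (uncurry Q) (z 0, z 1) := by
    have e : uncurry Q = fun p : ℝ × ℝ =>
        Tx p.1 * g t (p.1 + lam * (p.2 - T p.1)) -
          (1 - lam * Tx p.1) * (p.2 - T p.1) * gx t (p.1 + lam * (p.2 - T p.1)) := by
      funext p; rfl
    rw [e]
    exact (hTxp.mul hgp).sub ((((differentiableAt_const _).sub (hTxp.const_mul lam)).mul hsp).mul hgxp)
  -- the four partials
  have hPx : HasDerivAt (fun a => P a (z 1))
      (gx t ξ₀ * (1 - lam * Tx (z 0)) +
        (lam * (-Tx (z 0)) * gx t ξ₀ + lam * (z 1 - T (z 0)) * (gxx * (1 - lam * Tx (z 0))))) (z 0) := by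
    have h := hga.add ((hsa.const_mul lam).mul hgxa)
    refine h.congr_deriv ?_
    simp only [hξ₀, shAbscissa_apply]
  have hPy : HasDerivAt (fun b => P (z 0) b)
      (gx t ξ₀ * lam + (lam * 1 * gx t ξ₀ + lam * (z 1 - T (z 0)) * (gxx * lam))) (z 1) := by
    have h := hgb.add ((hsb.const_mul lam).mul hgxb)
    refine h.congr_deriv ?_
    simp only [hξ₀, shAbscissa_apply]
  have hQx : HasDerivAt (fun a => Q a (z 1))
      (Txx * g t ξ₀ + Tx (z 0) * (gx t ξ₀ * (1 - lam * Tx (z 0))) -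
        ((-(lam * Txx)) * (z 1 - T (z 0)) * gx t ξ₀ + (1 - lam * Tx (z 0)) * (-Tx (z 0)) * gx t ξ₀ +
          (1 - lam * Tx (z 0)) * (z 1 - T (z 0)) * (gxx * (1 - lam * Tx (z 0))))) (z 0) := by
    have h1 : HasDerivAt (fun a => 1 - lam * Tx a) (-(lam * Txx)) (z 0) := by
      simpa using (hTxx.const_mul lam).const_sub 1
    have h := (hTxx.mul hga).sub ((h1.mul hsa).mul hgxa)
    refine h.congr_deriv ?_
    simp only [hξ₀, shAbscissa_apply, Pi.mul_apply]; ring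
  have hQy : HasDerivAt (fun b => Q (z 0) b)
      (Tx (z 0) * (gx t ξ₀ * lam) -
        ((1 - lam * Tx (z 0)) * 1 * gx t ξ₀ + (1 - lam * Tx (z 0)) * (z 1 - T (z 0)) * (gxx * lam))) (z 1) := by
    have h := (hgb.const_mul (Tx (z 0))).sub ((hsb.const_mul (1 - lam * Tx (z 0))).mul hgxb)
    refine h.congr_deriv ?_
    simp only [hξ₀, shAbscissa_apply]
  rw [hV, divergence_vec2_coordFun hPj hQj hPx hPy hQx hQy]
  ring

/-- **Transport by the sheared band**: for every profile `Θ_ref` differentiable at `Ψ(t,z)`,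
`Θ_ref ∘ Ψ` is transported at `(t,z)` by the sheared velocity. [folklore] -/
theorem transport_comp_shGraphPullback {Θ : E² → G} {lam : ℝ} {T Tx : ℝ → ℝ}
    {Ξ Ξx Ξt Ξxx Ξxt : ℝ → ℝ → ℝ} {t : ℝ} {z : E²}
    (hΘ : DifferentiableAt ℝ Θ (shGraphPullback lam T Ξ Ξx t z))
    (hTx : HasDerivAt T (Tx (z 0)) (z 0))
    (ht : HasDerivAt (fun s => Ξ s (shAbscissa lam T z)) (Ξt t (shAbscissa lam T z)) t)
    (hx : HasDerivAt (Ξ t) (Ξx t (shAbscissa lam T z)) (shAbscissa lam T z))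
    (hxx : HasDerivAt (Ξx t) (Ξxx t (shAbscissa lam T z)) (shAbscissa lam T z))
    (hxt : HasDerivAt (fun s => Ξx s (shAbscissa lam T z)) (Ξxt t (shAbscissa lam T z)) t)
    (hne : Ξx t (shAbscissa lam T z) ≠ 0) :
    deriv (fun s => Θ (shGraphPullback lam T Ξ Ξx s z)) t +
      fderiv ℝ (fun w => Θ (shGraphPullback lam T Ξ Ξx t w)) z
        (shGraphVelocity lam (axialRate Ξx Ξt) (axialRateDeriv Ξx Ξt Ξxx Ξxt) T Tx t z) = 0 :=
  transport_comp_of_pullback hΘ (hasDerivAt_shGraphPullback ht hxt hne).differentiableAt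
    (hasFDerivAt_shGraphPullback hTx hx hxx hne).differentiableAt
    (shGraph_pullback_identity hTx ht hx hxx hxt hne)

/-! ## The stream function -/

/-- **Derivative of the sheared stream function**:
`D_zH(t,z)[v] = (gₓ s (1 - λTₓ) - g Tₓ) v₀ + (gₓ s λ + g) v₁`, `s = z₁ - T(z₀)`, `g, gₓ` at `ξ(z)`.
[folklore] -/
theorem hasFDerivAt_shGraphStream {lam : ℝ} {g gx : ℝ → ℝ → ℝ} {T Tx : ℝ → ℝ} {t : ℝ} {z : E²}
    (hg : HasDerivAt (g t) (gx t (shAbscissa lam T z)) (shAbscissa lam T z))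
    (hT : HasDerivAt T (Tx (z 0)) (z 0)) :
    HasFDerivAt (shGraphStream lam g T t)
      ((gx t (shAbscissa lam T z) * (1 - lam * Tx (z 0)) * (z 1 - T (z 0)) +
            g t (shAbscissa lam T z) * (-Tx (z 0))) •
          (EuclideanSpace.proj (0 : Fin 2) : E² →L[ℝ] ℝ) +
        (gx t (shAbscissa lam T z) * lam * (z 1 - T (z 0)) + g t (shAbscissa lam T z)) •
          (EuclideanSpace.proj (1 : Fin 2) : E² →L[ℝ] ℝ)) z := by
  set ξ₀ := shAbscissa lam T z with hξ₀
  have hξeq : z 0 + lam * (z 1 - T (z 0)) = ξ₀ := by rw [hξ₀, shAbscissa_apply]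
  have hξa : HasDerivAt (fun a => a + lam * (z 1 - T a)) (1 - lam * Tx (z 0)) (z 0) :=
    ((hasDerivAt_id (z 0)).add ((hT.const_sub (z 1)).const_mul lam)).congr_deriv (by ring)
  have hξb : HasDerivAt (fun b => z 0 + lam * (b - T (z 0))) lam (z 1) :=
    ((((hasDerivAt_id (z 1)).sub_const (T (z 0))).const_mul lam).const_add (z 0)).congr_deriv (by ring)
  have hga : HasDerivAt (fun a => g t (a + lam * (z 1 - T a))) (gx t ξ₀ * (1 - lam * Tx (z 0))) (z 0) :=
    (hξeq ▸ hg).comp (z 0) hξa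
  have hgb : HasDerivAt (fun b => g t (z 0 + lam * (b - T (z 0)))) (gx t ξ₀ * lam) (z 1) :=
    (hξeq ▸ hg).comp (z 1) hξb
  have hsa : HasDerivAt (fun a => z 1 - T a) (-Tx (z 0)) (z 0) := hT.const_sub (z 1)
  have hsb : HasDerivAt (fun b => b - T (z 0)) 1 (z 1) := (hasDerivAt_id (z 1)).sub_const _
  have hTp : DifferentiableAt ℝ (fun p : ℝ × ℝ => T p.1) (z 0, z 1) :=
    hT.differentiableAt.comp (z 0, z 1) differentiableAt_fst
  have hsp : DifferentiableAt ℝ (fun p : ℝ × ℝ => p.2 - T p.1) (z 0, z 1) := differentiableAt_snd.sub hTp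
  have hξp : DifferentiableAt ℝ (fun p : ℝ × ℝ => p.1 + lam * (p.2 - T p.1)) (z 0, z 1) :=
    differentiableAt_fst.add (hsp.const_mul lam)
  have hgp : DifferentiableAt ℝ (fun p : ℝ × ℝ => g t (p.1 + lam * (p.2 - T p.1))) (z 0, z 1) := by
    have hd : DifferentiableAt ℝ (g t) ((fun p : ℝ × ℝ => p.1 + lam * (p.2 - T p.1)) (z 0, z 1)) := by
      simp only [hξeq]; exact hg.differentiableAt
    exact hd.comp (z 0, z 1) hξp
  have hHj : DifferentiableAt ℝ (uncurry fun a b : ℝ => g t (a + lam * (b - T a)) * (b - T a)) (z 0, z 1) := by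
    have e : (uncurry fun a b : ℝ => g t (a + lam * (b - T a)) * (b - T a)) = fun p : ℝ × ℝ =>
        g t (p.1 + lam * (p.2 - T p.1)) * (p.2 - T p.1) := by
      funext p; rfl
    rw [e]; exact hgp.mul hsp
  have hHa : HasDerivAt (fun a => g t (a + lam * (z 1 - T a)) * (z 1 - T a))
      (gx t ξ₀ * (1 - lam * Tx (z 0)) * (z 1 - T (z 0)) + g t ξ₀ * (-Tx (z 0))) (z 0) := by
    refine (hga.mul hsa).congr_deriv ?_
    simp only [hξ₀, shAbscissa_apply]
  have hHb : HasDerivAt (fun b => g t (z 0 + lam * (b - T (z 0))) * (b - T (z 0)))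
      (gx t ξ₀ * lam * (z 1 - T (z 0)) + g t ξ₀) (z 1) := by
    refine (hgb.mul hsb).congr_deriv ?_
    simp only [hξ₀, shAbscissa_apply, mul_one]
  exact hasFDerivAt_coordFun (g := fun a b : ℝ => g t (a + lam * (b - T a)) * (b - T a)) hHj hHa hHb

/-- **The sheared velocity is the perpendicular gradient of its stream function**:
`V = (∂_yH, -∂ₓH)` for `H = g(t, ξ) (y - T)`. [folklore] -/
theorem shGraphVelocity_eq_perp_fderiv_shGraphStream {lam : ℝ} {g gx : ℝ → ℝ → ℝ} {T Tx : ℝ → ℝ}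
    {t : ℝ} {z : E²} (hg : HasDerivAt (g t) (gx t (shAbscissa lam T z)) (shAbscissa lam T z))
    (hT : HasDerivAt T (Tx (z 0)) (z 0)) :
    shGraphVelocity lam g gx T Tx t z =
      vec2 (fderiv ℝ (shGraphStream lam g T t) z (EuclideanSpace.single 1 1))
        (-fderiv ℝ (shGraphStream lam g T t) z (EuclideanSpace.single 0 1)) := by
  rw [(hasFDerivAt_shGraphStream hg hT).fderiv, shGraphVelocity_apply, vec2_eq_vec2_iff]
  simp only [_root_.add_apply, _root_.smul_apply, smul_eq_mul, PiLp.proj_apply,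
    PiLp.single_apply]
  refine ⟨?_, ?_⟩
  · simp only [Fin.isValue, if_false, if_true, mul_zero, mul_one, zero_add, zero_ne_one]
    ring
  · simp only [Fin.isValue, one_ne_zero, if_false, if_true, mul_zero, mul_one, add_zero]
    ring

/-- **A static sheared band at rest has zero velocity**: `g(t,·) = 0`, `gₓ(t,·) = 0`. [folklore] -/
theorem shGraphVelocity_eq_zero {lam : ℝ} {g gx : ℝ → ℝ → ℝ} {T Tx : ℝ → ℝ} {t : ℝ} {w : E²}
    (hg : g t (shAbscissa lam T w) = 0) (hgx : gx t (shAbscissa lam T w) = 0) :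
    shGraphVelocity lam g gx T Tx t w = 0 := by
  rw [shGraphVelocity_apply, hg, hgx, vec2_eq_zero_iff]
  constructor <;> ring

/-! ## Smoothness of the sheared band -/

section Smoothness

variable {n : WithTop ℕ∞}

/-- The sheared abscissa is smooth in `(t, z)` (it does not depend on `t`). [folklore] -/
theorem contDiff_shAbscissa_snd {lam : ℝ} {T : ℝ → ℝ} (hT : ContDiff ℝ n T) :
    ContDiff ℝ n fun p : ℝ × E² => shAbscissa lam T p.2 := by
  have h0 : ContDiff ℝ n fun p : ℝ × E² => p.2 0 := (contDiff_coord 0).comp contDiff_snd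
  have h1 : ContDiff ℝ n fun p : ℝ × E² => p.2 1 := (contDiff_coord 1).comp contDiff_snd
  simp only [shAbscissa_apply]
  exact h0.add (contDiff_const.mul (h1.sub (hT.comp h0)))

/-- **The sheared pullback is smooth** when `T`, `Ξ` and the (nowhere vanishing) datum `Ξₓ` are.
[folklore] -/
theorem contDiff_uncurry_shGraphPullback {lam : ℝ} {T : ℝ → ℝ} {Ξ Ξx : ℝ → ℝ → ℝ}
    (hT : ContDiff ℝ n T) (hΞ : ContDiff ℝ n (uncurry Ξ)) (hΞx : ContDiff ℝ n (uncurry Ξx))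
    (hne : ∀ t x, Ξx t x ≠ 0) : ContDiff ℝ n (uncurry (shGraphPullback lam T Ξ Ξx)) := by
  have hξ : ContDiff ℝ n fun p : ℝ × E² => ((p.1, shAbscissa lam T p.2) : ℝ × ℝ) :=
    contDiff_fst.prodMk (contDiff_shAbscissa_snd hT)
  have h1 : ContDiff ℝ n fun p : ℝ × E² => uncurry Ξ (p.1, shAbscissa lam T p.2) := hΞ.comp hξ
  have h0 : ContDiff ℝ n fun p : ℝ × E² => p.2 0 := (contDiff_coord 0).comp contDiff_snd
  have h2 : ContDiff ℝ n fun p : ℝ × E² =>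
      (p.2 1 - T (p.2 0)) / uncurry Ξx (p.1, shAbscissa lam T p.2) :=
    (((contDiff_coord 1).comp contDiff_snd).sub (hT.comp h0)).div (hΞx.comp hξ)
      fun p => hne p.1 _
  exact contDiff_vec2 h1 h2

/-- **The sheared velocity is smooth** when its data `g, gₓ, T, Tₓ` are. [folklore] -/
theorem contDiff_uncurry_shGraphVelocity {lam : ℝ} {g gx : ℝ → ℝ → ℝ} {T Tx : ℝ → ℝ}
    (hg : ContDiff ℝ n (uncurry g)) (hgx : ContDiff ℝ n (uncurry gx)) (hT : ContDiff ℝ n T)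
    (hTx : ContDiff ℝ n Tx) : ContDiff ℝ n (uncurry (shGraphVelocity lam g gx T Tx)) := by
  have hξ : ContDiff ℝ n fun p : ℝ × E² => ((p.1, shAbscissa lam T p.2) : ℝ × ℝ) :=
    contDiff_fst.prodMk (contDiff_shAbscissa_snd hT)
  have h0 : ContDiff ℝ n fun p : ℝ × E² => p.2 0 := (contDiff_coord 0).comp contDiff_snd
  have hs : ContDiff ℝ n fun p : ℝ × E² => p.2 1 - T (p.2 0) :=
    ((contDiff_coord 1).comp contDiff_snd).sub (hT.comp h0)
  have h1 : ContDiff ℝ n fun p : ℝ × E² =>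
      uncurry g (p.1, shAbscissa lam T p.2) + lam * (p.2 1 - T (p.2 0)) * uncurry gx (p.1, shAbscissa lam T p.2) :=
    (hg.comp hξ).add ((contDiff_const.mul hs).mul (hgx.comp hξ))
  have h2 : ContDiff ℝ n fun p : ℝ × E² =>
      Tx (p.2 0) * uncurry g (p.1, shAbscissa lam T p.2) -
        (1 - lam * Tx (p.2 0)) * (p.2 1 - T (p.2 0)) * uncurry gx (p.1, shAbscissa lam T p.2) :=
    ((hTx.comp h0).mul (hg.comp hξ)).sub
      (((contDiff_const.sub (contDiff_const.mul (hTx.comp h0))).mul hs).mul (hgx.comp hξ))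
  exact contDiff_vec2 h1 h2

/-- **The sheared stream function is smooth** when `g, T` are. [folklore] -/
theorem contDiff_uncurry_shGraphStream {lam : ℝ} {g : ℝ → ℝ → ℝ} {T : ℝ → ℝ}
    (hg : ContDiff ℝ n (uncurry g)) (hT : ContDiff ℝ n T) :
    ContDiff ℝ n (uncurry (shGraphStream lam g T)) := by
  have hξ : ContDiff ℝ n fun p : ℝ × E² => ((p.1, shAbscissa lam T p.2) : ℝ × ℝ) :=
    contDiff_fst.prodMk (contDiff_shAbscissa_snd hT)
  have h0 : ContDiff ℝ n fun p : ℝ × E² => p.2 0 := (contDiff_coord 0).comp contDiff_snd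
  exact (hg.comp hξ).mul (((contDiff_coord 1).comp contDiff_snd).sub (hT.comp h0))

/-- **A profile moved by the sheared pullback is smooth.** [folklore] -/
theorem contDiff_uncurry_comp_shGraphPullback {Θ : E² → G} {lam : ℝ} {T : ℝ → ℝ} {Ξ Ξx : ℝ → ℝ → ℝ}
    (hΘ : ContDiff ℝ n Θ) (hT : ContDiff ℝ n T) (hΞ : ContDiff ℝ n (uncurry Ξ))
    (hΞx : ContDiff ℝ n (uncurry Ξx)) (hne : ∀ t x, Ξx t x ≠ 0) :
    ContDiff ℝ n (uncurry fun t z => Θ (shGraphPullback lam T Ξ Ξx t z)) :=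
  contDiff_uncurry_comp hΘ (contDiff_uncurry_shGraphPullback hT hΞ hΞx hne)

end Smoothness

end PlanarKinematics

end Literature.Analysis.FluidPDE
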